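import Mathlib
import Summits.PneNP.PneNP.Theorems.ClusUniversalCertificateCoordBookBlk

/-!
# Route ClusUniversalCertificate, crux `UniversalCertAll` — path `coord`: block-layer bookkeeping WITH TRANSLATE CREDIT

Support file for `stmt-PneNP-19683` (cell pnp-ideate, route `ClusUniversalCertificate`, rung F-N1; path `coord` of pnp-ideate-p1,
skeleton v11 sha16 e5cba65d; objects of record `…CoordDefs.lean` p516754 / `…CoordBlkDefs.lean` p519312, namespace `…Theorems.ClusCoord`).
The FREE STRENGTHENING of the block step proposed by pnp-ideate-lit g9 (STATUS 10:30Z, memo pnp-ideate-lit/ROUND-8.md §X): in the peel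
induction the hypothesis `UCMixDim M'` certifies every TRANSLATE `S + t` of a member `S`, and `D(S + t) = D(S)`, `|S + t| = |S|`, while
`Z_j(S + t)` counts the points of `S` whose block `j` equals `t|_{B_j}` — so each member may be certified at its best translate.  The
bookkeeping of the landed `ClusCoord.stub_cBookBlk` goes through verbatim with the WEAKER block layer inequality

  `BLayerIneqT`:  `D(Y) ≤ Σ_S D(S) + (bsize k − 1)|Y| + 2^{bsize k} Z_k(Y) + Σ_{j ≠ k} 2^{bsize j} (Z_j(Y) − Σ_S Z_j(S + t_S))`

for a family of members WITH chosen translates `(S, t_S)` (`cBookBlkT`).  Ingredients: translation can only lower the certificate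
codimension (`acodim_image_add_le`, via the pointwise translate of an optimal flat), hence `dsum M' S ≤ dsum M' (S + t)`; the emptied
block `k` contributes `2^0·|S + t| = |S|`; `Σ_S |S| = |Y|`.  (With `t_S = 0` for all `S` and `Σ_S Z_j(S) = Z_j(Y)` this is `stub_cBookBlk`.)
FRONTIER rung F-N1 (a combinatorial certificate about affine flats in `𝔽₂^M`); bookkeeping only — the conjecture and the crux are OPEN;
nothing here bears on P vs NP.
-/

set_option linter.dupNamespace false -- `Summit.PneNP.PneNP.…`: summit = sub-problem name (D-0017 single-conjunct layout)

open scoped Pointwise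

namespace Summit.PneNP.PneNP.Theorems.ClusCoordBookBlkT

open Finset
open Summit.PneNP.PneNP.Theorems.ClusCoord (acodim dsum bsize zcount UCMix kemb IsBLayerFamily)
open Summit.PneNP.PneNP.Theorems.ClusCoordBook (list_sum_map_finset_sum list_sum_map_le list_sum_map_sub list_sum_map_mul
  list_sum_card_filter_eq)
open Summit.PneNP.PneNP.Theorems.ClusCoordBookBlk (blk_kemb_ne bsize_kemb_self bsize_kemb_of_ne sum_bsize_sub_one_kemb
  blockZero_kemb_self sum_card_blk)

variable {M M' n : ℕ}

/-! ## Translates -/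

/-- A translate has the same cardinality. -/
theorem card_image_add (S : Finset (Fin M' → ZMod 2)) (t : Fin M' → ZMod 2) :
    (S.image fun x => x + t).card = S.card :=
  Finset.card_image_of_injective _ (add_left_injective t)

/-- Translation can only lower the certificate codimension of a point of `S`. -/
theorem acodim_image_add_le (S : Finset (Fin M' → ZMod 2)) (t : Fin M' → ZMod 2) (x : Fin M' → ZMod 2) (hx : x ∈ S) :
    acodim M' (S.image fun x => x + t) (x + t) ≤ acodim M' S x := by
  -- an optimal flat through `x` inside `S`
  have hne : {c : ℕ | ∃ A : AffineSubspace (ZMod 2) (Fin M' → ZMod 2), x ∈ A ∧ (∀ z ∈ A, z ∈ S) ∧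
      M' ≤ Module.finrank (ZMod 2) A.direction + c}.Nonempty := by
    refine ⟨M', AffineSubspace.mk' x ⊥, AffineSubspace.self_mem_mk' _ _, ?_, by simp⟩
    intro z hz
    rw [AffineSubspace.mem_mk'] at hz
    have : z = x := by
      rw [Submodule.mem_bot, vsub_eq_sub, sub_eq_zero] at hz
      exact hz
    rw [this]
    exact hx
  obtain ⟨A, hxA, hAS, hdim⟩ := Nat.sInf_mem hne
  -- its translate is a flat through `x + t` inside `S + t` with the same direction
  unfold acodim
  apply Nat.sInf_le
  refine ⟨t +ᵥ A, ?_, ?_, ?_⟩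
  · have : x + t = t +ᵥ x := by rw [vadd_eq_add, add_comm]
    rw [this]
    exact AffineSubspace.vadd_mem_pointwise_vadd_iff.mpr hxA
  · intro z hz
    rw [← SetLike.mem_coe, AffineSubspace.coe_pointwise_vadd, Set.mem_vadd_set] at hz
    obtain ⟨p, hp, rfl⟩ := hz
    rw [Finset.mem_image]
    exact ⟨p, hAS p hp, by rw [vadd_eq_add, add_comm]⟩
  · rw [AffineSubspace.pointwise_vadd_direction]
    exact hdim

/-- Hence `D(S) ≤ D(S + t)` (in fact equality; one direction suffices). -/
theorem dsum_le_dsum_image_add (S : Finset (Fin M' → ZMod 2)) (t : Fin M' → ZMod 2) :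
    dsum M' S ≤ dsum M' (S.image fun x => x + t) := by
  unfold dsum
  rw [Finset.sum_image fun a _ b _ hab => add_left_injective t hab]
  refine Finset.sum_le_sum fun x hx => ?_
  have := acodim_image_add_le S t x hx
  have h' : (acodim M' (S.image fun x => x + t) (x + t) : ℤ) ≤ (acodim M' S x : ℤ) := by exact_mod_cast this
  linarith

/-- The emptied block `k` vanishes at every point: `Z_k(T) = |T|` one block down. -/
theorem zcount_kemb_self (blk : Fin M → Fin n) (k : Fin n) (h : (univ.filter fun i => blk i ≠ k).card = M')
    (T : Finset (Fin M' → ZMod 2)) : zcount (blk ∘ kemb blk k M' h) k T = T.card := by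
  unfold zcount
  rw [Finset.filter_true_of_mem fun x _ => blockZero_kemb_self blk k h x]

end Summit.PneNP.PneNP.Theorems.ClusCoordBookBlkT

namespace Summit.PneNP.PneNP.Theorems.ClusCoord

open Finset
open Summit.PneNP.PneNP.Theorems.ClusCoordBook (list_sum_map_finset_sum list_sum_map_le list_sum_map_sub list_sum_map_mul)
open Summit.PneNP.PneNP.Theorems.ClusCoordBookBlk (bsize_kemb_self bsize_kemb_of_ne sum_bsize_sub_one_kemb sum_card_blk)
open Summit.PneNP.PneNP.Theorems.ClusCoordBookBlkT

/-- The block layer inequality WITH TRANSLATE CREDIT for a family of members with chosen translates `(S, t_S)`: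
`D(Y) ≤ Σ_S D(S) + (bsize k − 1)|Y| + 2^{bsize k} Z_k(Y) + Σ_{j ≠ k} 2^{bsize j}·(Z_j(Y) − Σ_S Z_j(S + t_S))`
(`Z_j` one block down for the members; with all `t_S = 0` the credit term vanishes for block layer families). -/
def BLayerIneqT (M n : ℕ) (blk : Fin M → Fin n) (Y : Finset (Fin M → ZMod 2)) (k : Fin n) (M' : ℕ)
    (h : (univ.filter fun i => blk i ≠ k).card = M') (L : List (Finset (Fin M' → ZMod 2) × (Fin M' → ZMod 2))) : Prop :=
  dsum M Y ≤ (L.map fun p => dsum M' p.1).sum + ((bsize blk k : ℤ) - 1) * (Y.card : ℤ) +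
    (2 : ℤ) ^ (bsize blk k) * (zcount blk k Y : ℤ) +
    ∑ j ∈ univ.erase k, (2 : ℤ) ^ (bsize blk j) *
      ((zcount blk j Y : ℤ) - (L.map fun p => (zcount (blk ∘ kemb blk k M' h) j (p.1.image fun x => x + p.2) : ℤ)).sum)

/-- **Block-layer bookkeeping with translate credit** (support theorem for stmt-PneNP-19683, path `coord`): if the members `S` of a block
layer family, each translated by its chosen `t_S`, satisfy the mixed certificate one block down, and `Y` satisfies the block layer
inequality with translate credit, then `Y` satisfies the mixed certificate. -/
theorem cBookBlkT : ∀ M M' n : ℕ, ∀ blk : Fin M → Fin n, ∀ Y : Finset (Fin M → ZMod 2), ∀ k : Fin n,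
    ∀ h : (univ.filter fun i => blk i ≠ k).card = M', ∀ L : List (Finset (Fin M' → ZMod 2) × (Fin M' → ZMod 2)),
    IsBLayerFamily blk Y k M' h (L.map Prod.fst) → BLayerIneqT M n blk Y k M' h L →
    (∀ p ∈ L, UCMix M' n (blk ∘ kemb blk k M' h) (p.1.image fun x => x + p.2)) → UCMix M n blk Y := by
  intro M M' n blk Y k h L hfam hineq hmem
  set blk' : Fin M' → Fin n := blk ∘ kemb blk k M' h with hblk'
  set B' : ℤ := ∑ j : Fin n, ((bsize blk' j : ℤ) - 1) with hB'
  -- the members' certificates AT THEIR TRANSLATES, pulled back to the members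
  have hmem' : ∀ p ∈ L, dsum M' p.1 - B' * (p.1.card : ℤ) ≤
      ∑ j : Fin n, (2 : ℤ) ^ (bsize blk' j) * (zcount blk' j (p.1.image fun x => x + p.2) : ℤ) := by
    intro p hp
    have h1 := hmem p hp
    unfold UCMix at h1
    rw [Finset.sum_sub_distrib, Finset.sum_const, nsmul_eq_mul, card_image_add, ← hB'] at h1
    change dsum M' (p.1.image fun x => x + p.2) - (p.1.card : ℤ) * B' ≤ _ at h1
    have h2 := dsum_le_dsum_image_add p.1 p.2
    linarith
  -- `Σ_S |S| = |Y|`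
  have hcard : (L.map fun p => (p.1.card : ℤ)).sum = (Y.card : ℤ) := by
    have := sum_card_blk blk Y k h (L.map Prod.fst) hfam
    rw [List.map_map] at this
    exact this
  -- summed over the family
  have hsum : (L.map fun p => dsum M' p.1).sum - B' * (Y.card : ℤ) ≤
      ∑ j : Fin n, (2 : ℤ) ^ (bsize blk' j) *
        (L.map fun p => (zcount blk' j (p.1.image fun x => x + p.2) : ℤ)).sum := by
    have h1 := list_sum_map_le L _ _ hmem'
    rw [list_sum_map_sub, list_sum_map_mul, hcard, list_sum_map_finset_sum] at h1
    refine h1.trans (le_of_eq (Finset.sum_congr rfl fun j _ => ?_))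
    rw [list_sum_map_mul]
  -- evaluate block `k` (empty one block down: weight `2^0`, `Z_k(S + t) = |S|`) and rename the other block sizes
  have hrhs : ∑ j : Fin n, (2 : ℤ) ^ (bsize blk' j) *
        (L.map fun p => (zcount blk' j (p.1.image fun x => x + p.2) : ℤ)).sum =
      (Y.card : ℤ) + ∑ j ∈ univ.erase k, (2 : ℤ) ^ (bsize blk j) *
        (L.map fun p => (zcount blk' j (p.1.image fun x => x + p.2) : ℤ)).sum := by
    rw [← Finset.add_sum_erase univ _ (Finset.mem_univ k)]
    rw [hblk', bsize_kemb_self blk k h, pow_zero, one_mul]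
    congr 1
    · rw [← hcard]
      congr 1
      refine List.map_congr_left fun p _ => ?_
      rw [zcount_kemb_self blk k h, card_image_add]
    · refine Finset.sum_congr rfl fun j hj => ?_
      rw [bsize_kemb_of_ne blk k h j (Finset.ne_of_mem_erase hj)]
  rw [hrhs] at hsum
  -- the block layer inequality with translate credit
  unfold BLayerIneqT at hineq
  rw [← hblk'] at hineq
  have hsplit : ∑ j ∈ univ.erase k, (2 : ℤ) ^ (bsize blk j) *
        ((zcount blk j Y : ℤ) - (L.map fun p => (zcount blk' j (p.1.image fun x => x + p.2) : ℤ)).sum) =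
      ∑ j ∈ univ.erase k, (2 : ℤ) ^ (bsize blk j) * (zcount blk j Y : ℤ) -
        ∑ j ∈ univ.erase k, (2 : ℤ) ^ (bsize blk j) *
          (L.map fun p => (zcount blk' j (p.1.image fun x => x + p.2) : ℤ)).sum := by
    rw [← Finset.sum_sub_distrib]
    refine Finset.sum_congr rfl fun j _ => ?_
    ring
  rw [hsplit] at hineq
  -- the goal, with `dsum` and the offsets `B = B' + bsize k`
  unfold UCMix
  rw [Finset.sum_sub_distrib, Finset.sum_const, nsmul_eq_mul, sum_bsize_sub_one_kemb blk k h,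
    ← Finset.add_sum_erase univ (fun j => (2 : ℤ) ^ (bsize blk j) * (zcount blk j Y : ℤ)) (Finset.mem_univ k)]
  change dsum M Y - _ ≤ _
  rw [← hblk', ← hB']
  linarith

end Summit.PneNP.PneNP.Theorems.ClusCoord
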